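import Summits.ResolutionOfSingularities.ResolutionOfSingularities.Theorems.FrobeniusClosingPatchingRelPerfectConeCubeSide
import Literature.AlgebraicGeometry.Resolution.BlowupChartQuotients
import HarnessLib

/-!
# Crux `PatchingRelPerfect` (stmt-ResolutionOfSingularities-16161), chain w52 — the rank-two member
# `f = x₀x₁ + x₂³`: chart-coordinate facts for the plane step on `B_i` (`i ≠ 0, 1`)

[OURS · L1 W5.2 · rung, DESIGN STAGE → instance facts] The assembly `…TwoPlanesPlane`
(`isRegular_of_isBlowup_tpPlane`) keeps as hypotheses a list of facts about the chart `B_i` of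
`Bl_𝔪 Spec S` and its coordinates `u, e₀, e₁`.  Those that are statements about the STAGE quotients
`B_i ⧸ ((u) + (e_j : j ∈ T))` are discharged here, uniformly in `i ∉ T`, from the polynomial model
`chartStageEquiv : κ[T_j : j ≠ i, j ∉ T] ≅ B_i ⧸ ((u) + (e_T))` (`Literature…BlowupChartQuotients`):

* `isDomain_quot_plane` — `B_i/(u, e₀)` is a domain (`T = {0}`);
* `isDomain_quot_plane_sup_e1` — `B_i/((u, e₀) + (e₁))` is a domain (`T = {0, 1}`);
* `isDomain_quot_u_e1`, `isRegularRing_quot_u_e1` — `B_i/(u, e₁)` is a regular domain (`T = {1}`);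
* `e1_notMem_plane` — `e₁ ∉ (u, e₀)`; `e0_notMem_u_sup_e1` — `e₀ ∉ (u) + (e₁)`; `e0_notMem_span_e1`.

What remains hypothetical in `isRegular_of_isBlowup_tpPlane` after this file: `B_i/(e₁)` a domain
(strict transform of the hyperplane `V(x₁)`) and the five exceptional-curve facts of the level-two
files.  `S` regular local of dimension four with regular system of parameters `x`; nothing here is
a statement of the manuscript under review.

## References

* The Stacks Project, Tags 0804, 0BIQ. [StacksProject]
-/

-- `Summit.<Summit>.<Sub>.Theorems` with `Sub = Summit` (single-conjunct summit, D-0017)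
set_option linter.dupNamespace false

noncomputable section

open CategoryTheory CategoryTheory.Limits AlgebraicGeometry Literature.AlgebraicGeometry.Resolution
open IsLocalRing

namespace Summit.ResolutionOfSingularities.ResolutionOfSingularities.Theorems

namespace TwoPlanesRung

open ConeRung

universe u

section PlaneFacts

variable {S : Type u} [CommRing S] [IsRegularLocalRing S] (x : Fin 4 → S)
  (hx : Ideal.span (Set.range x) = IsLocalRing.maximalIdeal S)
  (hd : (IsLocalRing.maximalIdeal S).spanFinrank = 4) (i : Fin 4)

local notation3 "M" => Ideal.span (Set.range x)
local notation3 "B" => chartRing x i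
local notation3 "uB" => chartBase x i (x i)
local notation3 "e[" j "]" => chartGen x i j
local notation3 "U" => Ideal.span {chartBase x i (x i)}
local notation3 "II" => Ideal.span (Set.range
  (Fin.cons (chartBase x i (x i)) (fun _ : Fin 1 => chartGen x i 0) : Fin 2 → chartRing x i))

/-! ### The stage ideals `(u) + (e_T)` for `T = {0}, {0,1}, {1}` -/

omit [IsRegularLocalRing S] in
/-- `(u, e₀)` (as the span of the plane family) is `(u) + (e₀)`. [folklore] -/
theorem span_range_plane_eq_sup : II = U ⊔ Ideal.span {e[0]} := by
  rw [Fin.range_cons, Set.range_const, Ideal.span_insert]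

omit [IsRegularLocalRing S] in
/-- The stage ideal for `T = {0}` is `(u, e₀)`. [folklore] -/
theorem chartStageIdeal_zero_eq : chartStageIdeal x i ⊥ {0} = II := by
  rw [chartStageIdeal, Ideal.map_bot, sup_bot_eq, Set.image_singleton, span_range_plane_eq_sup]

omit [IsRegularLocalRing S] in
/-- The stage ideal for `T = {0, 1}` is `(u, e₀) + (e₁)`. [folklore] -/
theorem chartStageIdeal_zero_one_eq : chartStageIdeal x i ⊥ {0, 1} = II ⊔ Ideal.span {e[1]} := by
  rw [chartStageIdeal, Ideal.map_bot, sup_bot_eq, Set.image_pair, Ideal.span_insert,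
    span_range_plane_eq_sup, sup_assoc]

omit [IsRegularLocalRing S] in
/-- The stage ideal for `T = {1}` is `(u, e₁)`. [folklore] -/
theorem chartStageIdeal_one_eq : chartStageIdeal x i ⊥ {1} = Ideal.span {uB, e[1]} := by
  rw [chartStageIdeal, Ideal.map_bot, sup_bot_eq, Set.image_singleton, Ideal.span_insert]

include hx in
/-- The coefficient ring `S ⧸ (𝔪 + 0)` of the stage models is a domain. [folklore] -/
theorem isDomain_residue_sup_bot : IsDomain (S ⧸ (M ⊔ ⊥)) := by
  rw [sup_bot_eq]
  exact isDomain_residue x hx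

include hx in
/-- The coefficient ring `S ⧸ (𝔪 + 0)` of the stage models is a regular ring. [folklore] -/
theorem isRegularRing_residue_sup_bot : IsRegularRing (S ⧸ (M ⊔ ⊥)) := by
  rw [sup_bot_eq]
  exact isRegularRing_residue x hx

/-! ### Integrality and regularity of the stage quotients -/

include hx hd in
/-- **`B_i ⧸ (u, e₀)` is a domain** (`i ≠ 0`). [cite: StacksProject, Tag 0BIQ] -/
theorem isDomain_quot_plane (hi : i ≠ 0) : IsDomain (B ⧸ II) := by
  haveI := isDomain_residue_sup_bot x hx
  have hiT : i ∉ ({0} : Set (Fin 4)) := fun h => hi (Set.mem_singleton_iff.mp h)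
  let ε := chartStageEquiv x i ⊥ {0} (isQuasiRegular_regularSystemOfParameters hd x hx) hiT
  exact MulEquiv.isDomain _
    ((Ideal.quotEquivOfEq (chartStageIdeal_zero_eq x i).symm).toMulEquiv.trans ε.symm.toMulEquiv)

include hx hd in
/-- **`B_i ⧸ ((u, e₀) + (e₁))` is a domain** (`i ≠ 0, 1`). [cite: StacksProject, Tag 0BIQ] -/
theorem isDomain_quot_plane_sup_e1 (hi : i ≠ 0) (hi1 : i ≠ 1) :
    IsDomain (B ⧸ (II ⊔ Ideal.span {e[1]})) := by
  haveI := isDomain_residue_sup_bot x hx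
  have hiT : i ∉ ({0, 1} : Set (Fin 4)) := by
    rintro (h | h)
    · exact hi h
    · exact hi1 (Set.mem_singleton_iff.mp h)
  let ε := chartStageEquiv x i ⊥ {0, 1} (isQuasiRegular_regularSystemOfParameters hd x hx) hiT
  exact MulEquiv.isDomain _
    ((Ideal.quotEquivOfEq (chartStageIdeal_zero_one_eq x i).symm).toMulEquiv.trans ε.symm.toMulEquiv)

include hx hd in
/-- **`B_i ⧸ (u, e₁)` is a domain** (`i ≠ 1`). [cite: StacksProject, Tag 0BIQ] -/
theorem isDomain_quot_u_e1 (hi1 : i ≠ 1) : IsDomain (B ⧸ Ideal.span {uB, e[1]}) := by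
  haveI := isDomain_residue_sup_bot x hx
  have hiT : i ∉ ({1} : Set (Fin 4)) := fun h => hi1 (Set.mem_singleton_iff.mp h)
  let ε := chartStageEquiv x i ⊥ {1} (isQuasiRegular_regularSystemOfParameters hd x hx) hiT
  exact MulEquiv.isDomain _
    ((Ideal.quotEquivOfEq (chartStageIdeal_one_eq x i).symm).toMulEquiv.trans ε.symm.toMulEquiv)

include hx hd in
/-- **`B_i ⧸ (u, e₁)` is a regular ring** (`i ≠ 1`; a polynomial ring over the residue field).
[cite: StacksProject, Tag 0BIQ] -/
theorem isRegularRing_quot_u_e1 (hi1 : i ≠ 1) : IsRegularRing (B ⧸ Ideal.span {uB, e[1]}) := by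
  haveI := isRegularRing_residue_sup_bot x hx
  have hiT : i ∉ ({1} : Set (Fin 4)) := fun h => hi1 (Set.mem_singleton_iff.mp h)
  let ε := chartStageEquiv x i ⊥ {1} (isQuasiRegular_regularSystemOfParameters hd x hx) hiT
  exact IsRegularRing.of_ringEquiv (R := MvPolynomial {j : Fin 4 // j ≠ i ∧ j ∉ ({1} : Set (Fin 4))}
    (S ⧸ (M ⊔ ⊥))) (ε.trans (Ideal.quotEquivOfEq (chartStageIdeal_one_eq x i)))

/-! ### Non-memberships -/

include hx hd in
/-- `e_j ∉ (u) + (e_T)` for `j ≠ i`, `j ∉ T` (a variable of the stage model). [cite: StacksProject, Tag 0BIQ] -/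
theorem chartGen_notMem_chartStageIdeal (T : Set (Fin 4)) (hiT : i ∉ T) (j : Fin 4) (hj : j ≠ i)
    (hjT : j ∉ T) : e[j] ∉ chartStageIdeal x i ⊥ T := by
  haveI := isDomain_residue_sup_bot x hx
  intro h
  let ε := chartStageEquiv x i ⊥ T (isQuasiRegular_regularSystemOfParameters hd x hx) hiT
  have hX : ε (MvPolynomial.X ⟨j, hj, hjT⟩) = 0 := by
    rw [chartStageEquiv_X]
    exact Ideal.Quotient.eq_zero_iff_mem.mpr h
  exact MvPolynomial.X_ne_zero (R := S ⧸ (M ⊔ ⊥)) (⟨j, hj, hjT⟩ : {j : Fin 4 // j ≠ i ∧ j ∉ T})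
    (ε.injective (hX.trans (map_zero ε).symm))

include hx hd in
/-- **`e₁ ∉ (u, e₀)`** (`i ≠ 0, 1`). [cite: StacksProject, Tag 0BIQ] -/
theorem e1_notMem_plane (hi : i ≠ 0) (hi1 : i ≠ 1) : e[1] ∉ II := by
  rw [← chartStageIdeal_zero_eq x i]
  exact chartGen_notMem_chartStageIdeal x hx hd i {0} (fun h => hi (Set.mem_singleton_iff.mp h)) 1
    hi1.symm (by simp)

include hx hd in
/-- **`e₀ ∉ (u) + (e₁)`** (`i ≠ 0, 1`). [cite: StacksProject, Tag 0BIQ] -/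
theorem e0_notMem_u_sup_e1 (hi : i ≠ 0) (hi1 : i ≠ 1) : e[0] ∉ U ⊔ Ideal.span {e[1]} := by
  rw [← Ideal.span_insert, ← chartStageIdeal_one_eq x i]
  exact chartGen_notMem_chartStageIdeal x hx hd i {1} (fun h => hi1 (Set.mem_singleton_iff.mp h)) 0
    hi.symm (by simp)

include hx hd in
/-- `e₀ ∉ (e₁)` (`i ≠ 0, 1`). [cite: StacksProject, Tag 0BIQ] -/
theorem e0_notMem_span_e1 (hi : i ≠ 0) (hi1 : i ≠ 1) : e[0] ∉ Ideal.span {e[1]} :=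
  fun h => e0_notMem_u_sup_e1 x hx hd i hi hi1 (Ideal.mem_sup_right h)

end PlaneFacts

end TwoPlanesRung

end Summit.ResolutionOfSingularities.ResolutionOfSingularities.Theorems

end
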